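/-
Copyright (c) 2026 The H21 project. Released under Apache 2.0 license.
-/
import Summits.RiemannHypothesis.RiemannHypothesis.Theorems.PfPersistenceGalerkinIndexLaw
import Summits.RiemannHypothesis.RiemannHypothesis.Theorems.PfPersistenceM2ThresholdOpen
import Summits.RiemannHypothesis.RiemannHypothesis.Theorems.PfPersistenceM2EvenSectorUnconditional
import HarnessLib

/-!
# `P_F` persistence — GAL-4 readings: the UNCONDITIONAL ladder and the THRESHOLD RAYS of the Galerkin tower
# (cand-3, gen 11)

Mechanism / rigidity campaign of the `pub-rhpf` cell (variational seat M2 = cand-3); NO claim about RH is made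
anywhere in this file.  Everything here is RH-free and sorry-free; no numerical datum is used (all PROVED).

The index law `EvenNegIndexAtLeast n a ↔ ∃ N, GalerkinNegIndexAtLeast ζ n (a, N)` (`PfPersistenceGalerkinIndexLaw`)
lets every structural theorem of the M2 seat about the continuum negative even index descend to the tower of
truncations `A^{(N)}(a)` of the even block of `ζ`.  With `𝒬 = {ρ : ζ(ρ) = 0, Re ρ > 1/2, Im ρ > 0}` (one point per
off-line quadruple; `𝒬.encard ∈ ℕ ∪ {⊤}`):

* §1 LEVEL ONE IS WINDOW POSITIVITY: `¬ GalerkinNegIndexAtLeast d 1 win ↔ WindowPositive (d win)`, so level `0`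
  of the ladder below is the cell's class `AllWindowsPositive`.
* §2 THE UNCONDITIONAL LADDER (m2's `exists_evenNegIndexAtLeast_iff_encard`, Ingham-unconditional, + GAL-3/4):
  `(∃ window with Galerkin negative index ≥ n) ↔ n ≤ 𝒬.encard` and
  `(no window has Galerkin negative index ≥ n+1) ↔ 𝒬.encard ≤ n` for EVERY `n`, with NO finiteness hypothesis;
  `n = 0`: `AllWindowsPositive ζ ↔ 𝒬 = ∅`; `n = 1`: `(∀ windows, N ≥ 1: ε₂^{(N)}(a) ≥ 0) ↔ 𝒬.encard ≤ 1` —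
  the finiteness / "𝒬 infinite ∨ …" provisos of the gen-10/11 readings are gone.
* §3 SHORT WINDOWS: every truncation at half-length `a ≤ (log 2)/2` is positive semidefinite (Yoshida's wall
  descends to the tower); a window carrying `n+1` negative Galerkin directions can be strictly SHORTENED.
* §4 THRESHOLD RAYS: if `n+1 ≤ 𝒬.encard`, the set of half-lengths `a` at which SOME truncation carries `n+1`
  negative directions is exactly the open ray `(a₀, ∞)`, `a₀ ≥ (log 2)/2` (m2's sharp threshold theorem);
  DICHOTOMIES (unconditional): the `ε₂`-negativity lengths `{a | ∃ N ≥ 1, ε₂^{(N)}(a) < 0}` are `∅` or an open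
  ray above `(log 2)/2`; the `ε₁`-negativity lengths likewise (`∅` exactly under RH).
-/

set_option linter.dupNamespace false

noncomputable section

open Complex Filter Set MeasureTheory Topology Matrix Finset
open scoped Real ComplexConjugate

namespace Summit.RiemannHypothesis.RiemannHypothesis.Theorems.PfPersistence

open Literature.NumberTheory.LFunctions Literature.NumberTheory.LFunctions.WeilContinuous
open Literature.NumberTheory.LFunctions.ZetaZeros
open Summit.RiemannHypothesis.RiemannHypothesis.Theorems.PfPersistenceM2NegIndex

-- `𝒬` = the open quadrant of non-trivial zeros (a NOTATION, literally the set of the M2 files).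
set_option quotPrecheck false in
local notation "𝒬" => {ρ : ℂ | ρ ∈ riemannZetaNontrivialZeros ∧ 1 / 2 < ρ.re ∧ 0 < ρ.im}

/-! ## §1 Level one is window positivity -/

/-- PROVED: no Galerkin negative direction at a window iff the window matrix is positive semidefinite
(`WindowPositive`). [folklore] -/
theorem not_galerkinNegIndexAtLeast_one_iff_windowPositive (d : Datum) (win : Window) :
    ¬ GalerkinNegIndexAtLeast d 1 win ↔ WindowPositive (d win) := by
  rw [galerkinNegIndexAtLeast_one_iff, ← exists_form_neg_iff_bottomRayleigh_neg, not_exists]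
  unfold WindowPositive
  exact forall_congr' fun v ↦ not_lt

/-- PROVED: level `0` of the Galerkin ladder is the class `AllWindowsPositive`. [folklore] -/
theorem forall_not_galerkinNegIndexAtLeast_one_iff_allWindowsPositive (d : Datum) :
    (∀ win : Window, ¬ GalerkinNegIndexAtLeast d 1 win) ↔ AllWindowsPositive d := by
  unfold AllWindowsPositive
  exact forall_congr' fun win ↦ not_galerkinNegIndexAtLeast_one_iff_windowPositive d win

/-! ## §2 The unconditional ladder -/

/-- **PROVED — UNCONDITIONAL: some window carries a Galerkin negative `n`-space iff `n ≤ 𝒬.encard`**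
(no finiteness hypothesis; `𝒬.encard = ⊤` allowed).  `→`: GAL-4 + m2's index theorem; `←`: m2's unconditional
`exists_evenNegIndexAtLeast_iff_encard` + GAL-3. RH-free. [folklore] -/
theorem exists_window_galerkinNegIndexAtLeast_iff_encard (n : ℕ) :
    (∃ win : Window, GalerkinNegIndexAtLeast zetaDatum n win) ↔ (n : ℕ∞) ≤ Set.encard 𝒬 := by
  constructor
  · rintro ⟨win, hwin⟩
    exact le_encard_quadrant_of_galerkinNegIndexAtLeast hwin
  · intro h
    obtain ⟨a, ha⟩ := (exists_evenNegIndexAtLeast_iff_encard n).2 h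
    have hpos : 0 < max a 1 := lt_of_lt_of_le one_pos (le_max_right a 1)
    obtain ⟨N, hN⟩ :=
      exists_galerkinNegIndexAtLeast_of_evenNegIndexAtLeast hpos (ha.mono (le_max_left a 1))
    exact ⟨_, hN⟩

/-- **PROVED — UNCONDITIONAL: no window carries a Galerkin negative `(n+1)`-space iff `𝒬.encard ≤ n`.**
RH-free. [folklore] -/
theorem forall_not_galerkinNegIndexAtLeast_succ_iff_encard_le (n : ℕ) :
    (∀ win : Window, ¬ GalerkinNegIndexAtLeast zetaDatum (n + 1) win) ↔ Set.encard 𝒬 ≤ n := by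
  rw [← forall_not_evenNegIndexAtLeast_succ_iff_encard]
  constructor
  · intro hno a ha
    have hpos : 0 < max a 1 := lt_of_lt_of_le one_pos (le_max_right a 1)
    obtain ⟨N, hN⟩ :=
      exists_galerkinNegIndexAtLeast_of_evenNegIndexAtLeast hpos (ha.mono (le_max_left a 1))
    exact hno _ hN
  · intro hno win hwin
    exact hno win.a (evenNegIndexAtLeast_of_galerkinNegIndexAtLeast hwin)

/-- PROVED (level `0`): `ζ` is all-window positive iff the open quadrant of zeros is empty — with
`PfPersistenceParityIndex.riemannHypothesis_iff_quadrant_eq_empty` this re-derives, through the index law, the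
tree's RH-EQUIVALENCE `allWindowsPositive_zeta_iff_riemannHypothesis` (no RH claim). [folklore] -/
theorem allWindowsPositive_zeta_iff_quadrant_eq_empty : AllWindowsPositive zetaDatum ↔ 𝒬 = (∅ : Set ℂ) := by
  rw [← forall_not_galerkinNegIndexAtLeast_one_iff_allWindowsPositive,
    forall_not_galerkinNegIndexAtLeast_succ_iff_encard_le 0, Nat.cast_zero, nonpos_iff_eq_zero,
    Set.encard_eq_zero]

/-- **PROVED (level `1`) — UNCONDITIONAL: the second Galerkin level is non-negative at EVERY window (`N ≥ 1`)
iff `𝒬.encard ≤ 1`** — the "𝒬 infinite ∨ #𝒬 ≤ 1" proviso of the gen-10 reading and the finiteness hypothesis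
of `forall_secondRayleigh_nonneg_iff_card_le_one` are both removed. RH-free. [folklore] -/
theorem forall_secondRayleigh_nonneg_iff_encard_le_one :
    (∀ win : Window, 0 < win.N → 0 ≤ secondRayleigh (zetaDatum win)) ↔ Set.encard 𝒬 ≤ 1 := by
  constructor
  · intro hno
    have h := (forall_not_galerkinNegIndexAtLeast_succ_iff_encard_le 1).1 fun win hwin ↦ by
      obtain ⟨a, N, ha⟩ := win
      have h' : GalerkinNegIndexAtLeast zetaDatum 2 ⟨a, N + 1, ha⟩ :=
        zeta_galerkinNegIndexAtLeast_mono (Nat.le_succ N) hwin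
      exact absurd (hno ⟨a, N + 1, ha⟩ (Nat.succ_pos N))
        (not_le.2 ((galerkinNegIndexAtLeast_two_iff ⟨a, N + 1, ha⟩ (Nat.succ_pos N)).1 h'))
    exact_mod_cast h
  · intro h win hN
    exact secondRayleigh_nonneg_of_encard_le_one h win hN

/-! ## §3 Short windows and shortening -/

/-- **PROVED — YOSHIDA'S WALL DESCENDS TO THE TOWER**: at half-length `a ≤ (log 2)/2` NO truncation of the even
block of `ζ` has a negative direction (any level, any `N`). [cite: Yoshida1992, Thm. 1 (p. 310)] -/
theorem not_galerkinNegIndexAtLeast_succ_of_le_log_two_half (win : Window) (h : win.a ≤ Real.log 2 / 2)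
    (n : ℕ) : ¬ GalerkinNegIndexAtLeast zetaDatum (n + 1) win := fun hG ↦
  not_evenNegIndexAtLeast_succ_of_le_log_two_half h n (evenNegIndexAtLeast_of_galerkinNegIndexAtLeast hG)

/-- PROVED: every truncation `A^{(N)}(a)` with `a ≤ (log 2)/2` is positive semidefinite.
[cite: Yoshida1992, Thm. 1 (p. 310)] -/
theorem windowPositive_zeta_of_le_log_two_half (win : Window) (h : win.a ≤ Real.log 2 / 2) :
    WindowPositive (zetaDatum win) :=
  (not_galerkinNegIndexAtLeast_one_iff_windowPositive _ _).1
    (not_galerkinNegIndexAtLeast_succ_of_le_log_two_half win h 0)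

/-- PROVED: in particular `0 ≤ ε₁^{(N)}(a)` and (for `N ≥ 1`) `0 ≤ ε₂^{(N)}(a)` whenever `a ≤ (log 2)/2`.
[cite: Yoshida1992, Thm. 1 (p. 310)] -/
theorem bottomRayleigh_nonneg_and_secondRayleigh_nonneg_of_le_log_two_half (win : Window)
    (h : win.a ≤ Real.log 2 / 2) :
    0 ≤ bottomRayleigh (zetaDatum win) ∧ (0 < win.N → 0 ≤ secondRayleigh (zetaDatum win)) := by
  refine ⟨not_lt.1 fun hneg ↦ ?_, fun hN ↦ not_lt.1 fun hneg ↦ ?_⟩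
  · exact not_galerkinNegIndexAtLeast_succ_of_le_log_two_half win h 0
      ((galerkinNegIndexAtLeast_one_iff _ win).2 hneg)
  · exact not_galerkinNegIndexAtLeast_succ_of_le_log_two_half win h 1
      ((galerkinNegIndexAtLeast_two_iff win hN).2 hneg)

/-- **PROVED — SHORTENING**: a window carrying `n+1` negative Galerkin directions can be strictly shortened
(at the price of a possibly larger truncation): m2's openness `EvenNegIndexAtLeast.exists_lt` through the
index law. RH-free. [folklore] -/
theorem exists_lt_of_galerkinNegIndexAtLeast_succ {n : ℕ} {win : Window}
    (h : GalerkinNegIndexAtLeast zetaDatum (n + 1) win) :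
    ∃ (b : ℝ) (hb : 0 < b), b < win.a ∧ ∃ N : ℕ, GalerkinNegIndexAtLeast zetaDatum (n + 1) ⟨b, N, hb⟩ := by
  obtain ⟨b, hba, hb⟩ := (evenNegIndexAtLeast_of_galerkinNegIndexAtLeast h).exists_lt
  have hpos : 0 < b := by
    by_contra hle
    exact not_evenNegIndexAtLeast_succ_of_le_log_two_half
      ((not_lt.1 hle).trans (div_nonneg (Real.log_nonneg one_le_two) zero_le_two)) n hb
  obtain ⟨N, hN⟩ := exists_galerkinNegIndexAtLeast_of_evenNegIndexAtLeast hpos hb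
  exact ⟨b, hpos, hba, N, hN⟩

/-! ## §4 Threshold rays -/

/-- **PROVED — THE GALERKIN THRESHOLD IS THE CONTINUUM THRESHOLD**: if `n+1 ≤ 𝒬.encard`, there is ONE
half-length `a₀ ≥ (log 2)/2` such that for every `a > 0`: some truncation `A^{(N)}(a)` carries `n+1` negative
directions iff `a₀ < a` (m2's sharp threshold theorem `exists_evenNegIndex_threshold_iff` through the index
law). RH-free. [folklore] -/
theorem exists_galerkin_threshold_iff {n : ℕ} (hK : ((n + 1 : ℕ) : ℕ∞) ≤ Set.encard 𝒬) :
    ∃ a₀ : ℝ, Real.log 2 / 2 ≤ a₀ ∧ ∀ (a : ℝ) (ha : 0 < a),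
      (∃ N : ℕ, GalerkinNegIndexAtLeast zetaDatum (n + 1) ⟨a, N, ha⟩) ↔ a₀ < a := by
  obtain ⟨a₀, h₀, h⟩ := exists_evenNegIndex_threshold_iff hK
  exact ⟨a₀, h₀, fun a ha ↦ (evenNegIndexAtLeast_iff_exists_galerkin ha).symm.trans (h a)⟩

/-- PROVED (the `ε₂` dial): if `2 ≤ 𝒬.encard`, the half-lengths at which SOME truncation (`N ≥ 1`) has a negative
second level form exactly the open ray `(a₂, ∞)`, `a₂ ≥ (log 2)/2`. RH-free. [folklore] -/
theorem exists_secondRayleigh_threshold_iff (hK : (2 : ℕ∞) ≤ Set.encard 𝒬) :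
    ∃ a₂ : ℝ, Real.log 2 / 2 ≤ a₂ ∧ ∀ (a : ℝ) (ha : 0 < a),
      (∃ N : ℕ, 0 < N ∧ secondRayleigh (zetaDatum ⟨a, N, ha⟩) < 0) ↔ a₂ < a := by
  obtain ⟨a₂, h₂, h⟩ := exists_galerkin_threshold_iff (n := 1) (by simpa using hK)
  refine ⟨a₂, h₂, fun a ha ↦ (Iff.intro ?_ ?_).trans (h a ha)⟩
  · rintro ⟨N, hN, hneg⟩
    exact ⟨N, (galerkinNegIndexAtLeast_two_iff ⟨a, N, ha⟩ hN).2 hneg⟩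
  · rintro ⟨N, hN⟩
    exact ⟨N + 1, Nat.succ_pos N, (galerkinNegIndexAtLeast_two_iff ⟨a, N + 1, ha⟩ (Nat.succ_pos N)).1
      (zeta_galerkinNegIndexAtLeast_mono (Nat.le_succ N) hN)⟩

/-- PROVED (the `ε₁` dial, structure under `¬RH`; no RH claim): if RH fails, the half-lengths at which SOME
truncation fails to be positive semidefinite form exactly an open ray `(a₁, ∞)`, `a₁ ≥ (log 2)/2`. [folklore] -/
theorem exists_bottomRayleigh_threshold_iff_of_not_riemannHypothesis (hRH : ¬ RiemannHypothesis) :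
    ∃ a₁ : ℝ, Real.log 2 / 2 ≤ a₁ ∧ ∀ (a : ℝ) (ha : 0 < a),
      (∃ N : ℕ, bottomRayleigh (zetaDatum ⟨a, N, ha⟩) < 0) ↔ a₁ < a := by
  obtain ⟨a₁, h₁, h⟩ := exists_evenNegIndex_threshold_iff_of_not_riemannHypothesis hRH
  refine ⟨a₁, h₁, fun a ha ↦
    (Iff.intro ?_ ?_).trans ((evenNegIndexAtLeast_iff_exists_galerkin ha).symm.trans (h a))⟩
  · rintro ⟨N, hneg⟩
    exact ⟨N, (galerkinNegIndexAtLeast_one_iff _ _).2 hneg⟩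
  · rintro ⟨N, hN⟩
    exact ⟨N, (galerkinNegIndexAtLeast_one_iff _ _).1 hN⟩

/-- **PROVED — THE `ε₂` RAY DICHOTOMY (unconditional, RH-free)**: the set of half-lengths `a > 0` at which some
truncation (`N ≥ 1`) of the even block of `ζ` has a negative second level is EITHER empty (iff `𝒬.encard ≤ 1`)
OR an open ray `(a₂, ∞)` with `a₂ ≥ (log 2)/2` (iff `2 ≤ 𝒬.encard`). [folklore] -/
theorem secondRayleigh_negLengths_empty_or_ray :
    {a : ℝ | ∃ (ha : 0 < a) (N : ℕ), 0 < N ∧ secondRayleigh (zetaDatum ⟨a, N, ha⟩) < 0} = ∅ ∨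
      ∃ a₂ : ℝ, Real.log 2 / 2 ≤ a₂ ∧
        {a : ℝ | ∃ (ha : 0 < a) (N : ℕ), 0 < N ∧ secondRayleigh (zetaDatum ⟨a, N, ha⟩) < 0} = Ioi a₂ := by
  by_cases hK : (2 : ℕ∞) ≤ Set.encard 𝒬
  · right
    obtain ⟨a₂, h₂, h⟩ := exists_secondRayleigh_threshold_iff hK
    refine ⟨a₂, h₂, Set.ext fun a ↦ ⟨fun ⟨ha, N, hN, hneg⟩ ↦ (h a ha).1 ⟨N, hN, hneg⟩, fun ha₂ ↦ ?_⟩⟩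
    have ha : 0 < a :=
      lt_of_le_of_lt (h₂.trans' (div_nonneg (Real.log_nonneg one_le_two) zero_le_two)) ha₂
    exact ⟨ha, (h a ha).2 ha₂⟩
  · left
    have h1 : Set.encard 𝒬 ≤ 1 := by
      rw [not_le] at hK
      exact Order.le_of_lt_succ (by simpa [Order.succ_eq_add_one, one_add_one_eq_two] using hK)
    exact Set.ext fun a ↦ ⟨fun ⟨ha, N, hN, hneg⟩ ↦
      absurd (secondRayleigh_nonneg_of_encard_le_one h1 ⟨a, N, ha⟩ hN) (not_le.2 hneg),
      fun h ↦ absurd h (Set.notMem_empty a)⟩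

/-- **PROVED — THE `ε₁` RAY DICHOTOMY (unconditional, RH-free; no RH claim)**: the set of half-lengths `a > 0` at
which some truncation of the even block of `ζ` fails to be positive semidefinite is EITHER empty OR an open ray
`(a₁, ∞)` with `a₁ ≥ (log 2)/2` (the first alternative is RH by the tree's `allWindowsPositive_zeta_iff_…`, the
second is `¬RH`; which one holds is not claimed). [folklore] -/
theorem bottomRayleigh_negLengths_empty_or_ray :
    {a : ℝ | ∃ (ha : 0 < a) (N : ℕ), bottomRayleigh (zetaDatum ⟨a, N, ha⟩) < 0} = ∅ ∨
      ∃ a₁ : ℝ, Real.log 2 / 2 ≤ a₁ ∧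
        {a : ℝ | ∃ (ha : 0 < a) (N : ℕ), bottomRayleigh (zetaDatum ⟨a, N, ha⟩) < 0} = Ioi a₁ := by
  by_cases hRH : RiemannHypothesis
  · left
    exact Set.ext fun a ↦ ⟨fun ⟨ha, N, hneg⟩ ↦
      absurd ((galerkinNegIndexAtLeast_one_iff _ _).2 hneg)
        (not_galerkinNegIndexAtLeast_succ_of_riemannHypothesis hRH 0 ⟨a, N, ha⟩),
      fun h ↦ absurd h (Set.notMem_empty a)⟩
  · right
    obtain ⟨a₁, h₁, h⟩ := exists_bottomRayleigh_threshold_iff_of_not_riemannHypothesis hRH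
    refine ⟨a₁, h₁, Set.ext fun a ↦ ⟨fun ⟨ha, N, hneg⟩ ↦ (h a ha).1 ⟨N, hneg⟩, fun ha₁ ↦ ?_⟩⟩
    have ha : 0 < a :=
      lt_of_le_of_lt (h₁.trans' (div_nonneg (Real.log_nonneg one_le_two) zero_le_two)) ha₁
    exact ⟨ha, (h a ha).2 ha₁⟩

end Summit.RiemannHypothesis.RiemannHypothesis.Theorems.PfPersistence
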